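import Literature.NumberTheory.Rogawski1990.AdelicStableOrbitalSupportFiniteHolds
import Literature.NumberTheory.Rogawski1990.MatchingAdeleConjOfHermitian
import Literature.NumberTheory.Rogawski1990.AdelicStableClassesProduct
import HarnessLib

/-!
# The adelic stable class of the INNER FORM over `γ_H` READS as a restricted product:
# `𝒞_𝐀(γ_H) ≅ {(δ_v)_v : (γ_H)_v → out δ_v, δ_v = [γ_v] a.e.} × 𝒞_∞` for `G′ = U(H′)`
(Rogawski (1990), §3.3 p. 21: «`𝒪_st(γ∕𝐀)` … `γ′_v` is conjugate to `γ` by an element of `K_v` for almost all `v`»; §4.3 p. 44: «we may therefore set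
`Φ^κ(γ, f) = Π_v Φ^{κ_v}(γ, f_v)`»; §5.4 pp. 72–73; Kottwitz (1986) Prop. 7.1)

Topic `NumberTheory/Rogawski1990`; namespace `Literature.NumberTheory.Rogawski1990`.  THEOREMS ONLY: no definition, no named fact, no instance, no `sorry`.
Cell `pub/hodgecm-mathlib`, ENGINE T1, O11 «T1b assembly» step (E2-G′): the `G′`-SIDE TWIN of ★ (E2) `AdelicStableClassesProduct` (there: the quasi-split
`G = U(Φ₃)` and the carrier ★ `MatchingAdeleG.classes L H γ₀`) and of ★ (E2-H) `AdelicStableClassesProductH`.  Here the carrier is ★ typ3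
`adelicStableClassesOver L H′ γ_H` — the `G′(𝐀)`-classes of the matching adèles ★ `MatchingAdele L H′ γ_H` (T1b-9 `AdelicStableConjugacy`: ONE adèle
`γ̄ ∈ U(H′)(𝔸_L)` with `(γ_H)_v → γ̄_v` at every finite place and `γ_H ⊗ 1 → γ̄_∞`), the index set of the `κ`-twisted sums `Σ_{δ ∈ 𝒞_𝐀} κ(obs δ) Φ(δ, f′)` of
(4.3.3) ∕ (5.4.2) (★ `adelicKappaOrbitalIntegralG'`).  This file supplies the DICTIONARY hypotheses (img)(ev)(inj)(surj) of ★ (E1)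
`Literature.Topology.Algebra.RestrictedProduct.finsum_mem_eq_finsum_mul_prod_finsum_of_factor` for that class set with the class maps
`π_v := ConjClasses.map (toLocal v)`, `π_∞ := ConjClasses.map archPart`, the local «stable» sets `St_v := {d | (γ_H)_v → out d}` (★ `IsLocalNormPair`), the
archimedean one `St_∞ := {b | γ_H ⊗ 1 → out b}` (★ `IsArchNormPair`), and the base classes `e_v := [γ_v]` of a RATIONAL image `γ ∈ U(H′)(L⁺)` of `γ_H`
(★ `IsNormPair L H′ γ_H γ` — the case the elliptic stabilisation reads: `𝒪′_st ↦ 𝒪_st` [§14.5 p. 238]):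

* §0 the rational base point: `γ_H → γ` LOCALISES — `(γ_H)_v → γ_v` at every finite `v` (`isLocalNormPair_rationalComponent_toLocal_toAdelic`) and
  `γ_H ⊗ 1 → γ ⊗ 1` (`isArchNormPair_rationalArch_cmRationalToArch`); hence `[toAdelic γ] ∈ 𝒞_𝐀(γ_H)` (`mk_toAdelic_mem_adelicStableClassesOver`);
* §1 (img) `MatchingAdele.isLocalNormPair_out_map_toLocal`, `MatchingAdele.isArchNormPair_out_map_archPart`;
* §2 (ev) `MatchingAdele.eventually_map_toLocal_eq_mk` — the local class is the base class `[γ_v]` at all but finitely many `v` (★ F0P3a-p03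
  `eventually_exists_mem_conj_matchingAdele`: [Kt₄] Prop. 7.1 in the `K′_v`-form, PROVED for hermitian non-degenerate `H′` — no named fact enters);
* §3 (inj) `MatchingAdele.eq_of_forall_map_toLocal_eq_of_map_archPart_eq` — a class of `𝒞_𝐀(γ_H)` is determined by its local classes and its archimedean
  class; REFERENCE-FREE (no rational image needed): integral conjugators a.e. by the RELATIVE `K′_v`-form ★ F0P3a-p08 `MatchingAdele.eventually_forall_exists_conj`,
  glued by ★ `UnitaryGroup.isConj_of_isConj_archPart_of_forall_exists_conj`;
* §4 (surj) `MatchingAdele.exists_mem_classes_of_forall` — every family of local classes in the `St_v`, equal to `[γ_v]` a.e., with every archimedean class in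
  `St_∞`, is read by some class of `𝒞_𝐀(γ_H)` (★ `UnitaryGroup.exists_adelic_of_eventually_mem`, representatives `γ_v` on the base classes).
HC_CM is proved only modulo the printed citations until rung 0 closes; this file is unconditional.

## References
* [Rogawski1990] J. D. Rogawski, *Automorphic Representations of Unitary Groups in Three Variables*, Ann. of Math. Stud. 123 (1990), §3.3 p. 21, §4.3 p. 44,
  §5.4 pp. 72–73, §14.5 p. 238.
* [Kottwitz1986] R. E. Kottwitz, *Stable trace formula: elliptic singular terms*, Math. Ann. 275 (1986), Prop. 7.1.
* [BorelJacquet1979] A. Borel, H. Jacquet, *Automorphic forms and automorphic representations*, PSPM 33.1 (1979), §4.1.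
-/

noncomputable section

open NumberField IsDedekindDomain Filter
open scoped Matrix MatrixGroups

namespace Literature.NumberTheory.Rogawski1990

open Literature.NumberTheory.Automorphic

section DictionaryGp

variable {L : Type} [Field L] [NumberField L] [IsCMField L] {H' : Matrix (Fin 3) (Fin 3) L}
  {γH : (UnitaryGroup.cmDatum L 2 (Matrix.of fun i j : Fin 2 => if i.val + j.val + 1 = 2 then (1 : L) else 0)).Rational ×
    (UnitaryGroup.cmDatum L 1 (Matrix.of fun i j : Fin 1 => if i.val + j.val + 1 = 1 then (1 : L) else 0)).Rational}

/-! ## §0 The rational base point: a global `γ_H → γ` localises at every place -/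

/-- **`γ_H → γ` localises at the finite places**: for a rational image `γ ∈ U(H′)(L⁺)` of `γ_H` (★ `IsNormPair`: `ι(γ_H) ↔ γ` in `GL₃(L)`), the components
match — `(γ_H)_v → γ_v` (★ `IsLocalNormPair` at ★ `rationalComponent`): `IsConj` pushed along `L → 𝔸_L → ∏_{w∣v} L_w` (★ `corresponds_toLocal_toAdelic`), and
`(ι γ_H)_v = ι_v((γ_H)_v)` (★ `toAdelic_endoEmbRational`, ★ `toLocal_endoEmbAdelic`). [cite: Rogawski1990, §4.3 p. 43; §14.1 p. 232] -/
theorem isLocalNormPair_rationalComponent_toLocal_toAdelic {γ : (UnitaryGroup.cmDatum L 3 H').Rational} (hγ : IsNormPair L H' γH γ)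
    (v : HeightOneSpectrum (𝓞 ↥(maximalRealSubfield L))) :
    IsLocalNormPair L H' v (rationalComponent L γH v) ((UnitaryGroup.cmDatum L 3 H').toLocal v ((UnitaryGroup.cmDatum L 3 H').toAdelic γ)) := by
  have h := corresponds_toLocal_toAdelic hγ v
  rw [toAdelic_endoEmbRational, toLocal_endoEmbAdelic] at h
  exact h

/-- **`γ_H → γ` localises at infinity**: `γ_H ⊗ 1 → γ ⊗ 1` (★ `IsArchNormPair` at ★ `rationalArch` against ★ `cmRationalToArch γ`): `IsConj` pushed along
`GL₃(L) → GL₃(L ⊗ ℝ)` (★ `coe_endoEmbRational`, ★ `map_endoGL`, ★ `coe_cmRationalToArch`). [cite: Rogawski1990, §4.3 p. 44; §14.3 p. 234] -/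
theorem isArchNormPair_rationalArch_cmRationalToArch {γ : (UnitaryGroup.cmDatum L 3 H').Rational} (hγ : IsNormPair L H' γH γ) :
    IsArchNormPair L H' (rationalArch L γH) (cmRationalToArch L 3 H' γ) := by
  have h : IsConj (Matrix.GeneralLinearGroup.map (mixedEmbedding L) ((endoEmbRational L γH).val : GL (Fin 3) L))
      (Matrix.GeneralLinearGroup.map (mixedEmbedding L) (γ.val : GL (Fin 3) L)) :=
    (Matrix.GeneralLinearGroup.map (mixedEmbedding L)).map_isConj hγ
  rw [coe_endoEmbRational, map_endoGL] at h
  exact h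

/-- **The diagonal image of a rational image is a matching adèle**: `γ_H → γ` ⇒ `[toAdelic γ] ∈ 𝒞_𝐀(γ_H)` (★ `adelicStableClassesOver`; `(toAdelic γ)_∞ = γ ⊗ 1`,
★ `archPart_cmDatum_toAdelic`). [cite: Rogawski1990, §3.3 p. 21; §5.4 p. 72] -/
theorem mk_toAdelic_mem_adelicStableClassesOver {γ : (UnitaryGroup.cmDatum L 3 H').Rational} (hγ : IsNormPair L H' γH γ) :
    ConjClasses.mk ((UnitaryGroup.cmDatum L 3 H').toAdelic γ) ∈ adelicStableClassesOver L H' γH :=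
  ⟨⟨(UnitaryGroup.cmDatum L 3 H').toAdelic γ, fun v => isLocalNormPair_rationalComponent_toLocal_toAdelic hγ v, by
    rw [archPart_cmDatum_toAdelic]
    exact isArchNormPair_rationalArch_cmRationalToArch hγ⟩, rfl⟩

/-! ## §1 (img) local and archimedean classes of `𝒞_𝐀(γ_H)` match `γ_H` -/

/-- **(img, finite places)**: for `c ∈ 𝒞_𝐀(γ_H)` and a finite place `v`, the representative of the local class `ConjClasses.map (toLocal v) c` MATCHES
`(γ_H)_v` (★ `MatchingAdele.isLocalNormPair`; `→` is constant on stable classes, ★ `Corresponds.of_isStablyConj_right`). [cite: Rogawski1990, §3.3 p. 21] -/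
theorem MatchingAdele.isLocalNormPair_out_map_toLocal {c : ConjClasses (UnitaryGroup.cmDatum L 3 H').Adelic}
    (hc : c ∈ adelicStableClassesOver L H' γH) (v : HeightOneSpectrum (𝓞 ↥(maximalRealSubfield L))) :
    IsLocalNormPair L H' v (rationalComponent L γH v) (Quotient.out (ConjClasses.map ((UnitaryGroup.cmDatum L 3 H').toLocal v) c)) := by
  obtain ⟨p, rfl⟩ := hc
  exact (p.isLocalNormPair v).of_isStablyConj_right (isStablyConj_of_isConj (isConj_out_conjClasses_mk _))

/-- **(img, archimedean)**: the representative of the archimedean class `ConjClasses.map archPart c` of `c ∈ 𝒞_𝐀(γ_H)` matches `γ_H ⊗ 1`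
(★ `MatchingAdele.isArchNormPair`). [cite: Rogawski1990, §4.3 p. 44; §5.4 p. 72] -/
theorem MatchingAdele.isArchNormPair_out_map_archPart {c : ConjClasses (UnitaryGroup.cmDatum L 3 H').Adelic}
    (hc : c ∈ adelicStableClassesOver L H' γH) :
    IsArchNormPair L H' (rationalArch L γH)
      (Quotient.out (ConjClasses.map (UnitaryGroup.archPart (↥(maximalRealSubfield L)) L (IsCMField.complexConj L) 3 H') c)) := by
  obtain ⟨p, rfl⟩ := hc
  exact p.isArchNormPair.of_isStablyConj_right (isStablyConj_of_isConj (isConj_out_conjClasses_mk _))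

/-! ## §2 (ev) the local class is the base class almost everywhere -/

/-- **(ev)**: for `H′` hermitian non-degenerate, `γ_H` `G`-regular with a rational image `γ ∈ U(H′)(L⁺)`, the local class of any `c ∈ 𝒞_𝐀(γ_H)` is the base class
`[γ_v]` for all but finitely many `v` — the components of a matching adèle are `K′_v`-conjugate to `γ_v` a.e. (★ `eventually_exists_mem_conj_matchingAdele`,
[Kt₄] Prop. 7.1 PROVED on `U(H′)`). [cite: Rogawski1990, §3.3 p. 21; §4.3 p. 44] [cite: Kottwitz1986, Prop. 7.1] -/
theorem MatchingAdele.eventually_map_toLocal_eq_mk (hH' : (H'.map (cmConjRingHom L))ᵀ = H') (hdet : H'.det ≠ 0)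
    (hreg : IsGRegular (cmConjRingHom L) (Matrix.of fun i j : Fin 2 => if i.val + j.val + 1 = 2 then (1 : L) else 0)
      (Matrix.of fun i j : Fin 1 => if i.val + j.val + 1 = 1 then (1 : L) else 0)
      (Matrix.of fun i j : Fin 3 => if i.val + j.val + 1 = 3 then (1 : L) else 0) endoForm_antidiagOne γH)
    {γ : (UnitaryGroup.cmDatum L 3 H').Rational} (hγ : IsNormPair L H' γH γ)
    {c : ConjClasses (UnitaryGroup.cmDatum L 3 H').Adelic} (hc : c ∈ adelicStableClassesOver L H' γH) :
    ∀ᶠ v in cofinite, ConjClasses.map ((UnitaryGroup.cmDatum L 3 H').toLocal v) c =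
      ConjClasses.mk ((UnitaryGroup.cmDatum L 3 H').toLocal v ((UnitaryGroup.cmDatum L 3 H').toAdelic γ)) := by
  obtain ⟨p, rfl⟩ := hc
  filter_upwards [eventually_exists_mem_conj_matchingAdele L H' hH' hdet hreg hγ p] with v hv
  obtain ⟨k, -, hk⟩ := hv
  rw [conjClasses_map_mk, ConjClasses.mk_eq_mk_iff_isConj]
  exact (isConj_iff.2 ⟨k, hk⟩).symm

/-! ## §3 (inj) a class of `𝒞_𝐀(γ_H)` is determined by its local classes and its archimedean class — reference-free -/

/-- **(inj) — the gluing, REFERENCE-FREE** (`H′` hermitian non-degenerate, `γ_H` `G`-regular; no rational image of `γ_H` in `U(H′)` is needed): two classes of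
`𝒞_𝐀(γ_H)` with the same local class at every finite place and the same archimedean class are EQUAL — their representatives are conjugate at every place and, at
almost every place, conjugate BY AN INTEGRAL ELEMENT (both lie in `K′_v` and match `(γ_H)_v`: the RELATIVE `K′_v`-form of [Kt₄] Prop. 7.1, ★
`MatchingAdele.eventually_forall_exists_conj`), so they are `G′(𝐀)`-conjugate (★ `UnitaryGroup.isConj_of_isConj_archPart_of_forall_exists_conj`).
[cite: Rogawski1990, §3.3 p. 21] [cite: Kottwitz1986, Prop. 7.1] -/
theorem MatchingAdele.eq_of_forall_map_toLocal_eq_of_map_archPart_eq (hH' : (H'.map (cmConjRingHom L))ᵀ = H') (hdet : H'.det ≠ 0)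
    (hreg : IsGRegular (cmConjRingHom L) (Matrix.of fun i j : Fin 2 => if i.val + j.val + 1 = 2 then (1 : L) else 0)
      (Matrix.of fun i j : Fin 1 => if i.val + j.val + 1 = 1 then (1 : L) else 0)
      (Matrix.of fun i j : Fin 3 => if i.val + j.val + 1 = 3 then (1 : L) else 0) endoForm_antidiagOne γH)
    {c c' : ConjClasses (UnitaryGroup.cmDatum L 3 H').Adelic}
    (hc : c ∈ adelicStableClassesOver L H' γH) (hc' : c' ∈ adelicStableClassesOver L H' γH)
    (hv : ∀ v : HeightOneSpectrum (𝓞 ↥(maximalRealSubfield L)),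
      ConjClasses.map ((UnitaryGroup.cmDatum L 3 H').toLocal v) c = ConjClasses.map ((UnitaryGroup.cmDatum L 3 H').toLocal v) c')
    (ha : ConjClasses.map (UnitaryGroup.archPart (↥(maximalRealSubfield L)) L (IsCMField.complexConj L) 3 H') c =
      ConjClasses.map (UnitaryGroup.archPart (↥(maximalRealSubfield L)) L (IsCMField.complexConj L) 3 H') c') :
    c = c' := by
  obtain ⟨p, rfl⟩ := hc
  obtain ⟨p', rfl⟩ := hc'
  dsimp only at hv ha ⊢
  rw [ConjClasses.mk_eq_mk_iff_isConj]
  have ha' : IsConj (UnitaryGroup.archPart (↥(maximalRealSubfield L)) L (IsCMField.complexConj L) 3 H' p.adele)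
      (UnitaryGroup.archPart (↥(maximalRealSubfield L)) L (IsCMField.complexConj L) 3 H' p'.adele) :=
    ConjClasses.mk_eq_mk_iff_isConj.1 ha
  have hv' : ∀ v : HeightOneSpectrum (𝓞 ↥(maximalRealSubfield L)),
      IsConj ((UnitaryGroup.cmDatum L 3 H').toLocal v p.adele) ((UnitaryGroup.cmDatum L 3 H').toLocal v p'.adele) :=
    fun v => ConjClasses.mk_eq_mk_iff_isConj.1 (hv v)
  have hK : ∀ᶠ v in cofinite, ∃ k : (UnitaryGroup.cmDatum L 3 H').Local v, k ∈ UnitaryGroup.cmLocalIntegralLevel L 3 H' v ∧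
      k * (UnitaryGroup.cmDatum L 3 H').toLocal v p.adele * k⁻¹ = (UnitaryGroup.cmDatum L 3 H').toLocal v p'.adele := by
    filter_upwards [MatchingAdele.eventually_forall_exists_conj hH' hdet hreg, eventually_toLocal_mem_cmLocalIntegralLevel p.adele,
      eventually_toLocal_mem_cmLocalIntegralLevel p'.adele] with v hKv hint hint'
    obtain ⟨k, hk, hkp⟩ := hKv _ _ hint hint' (p.isLocalNormPair v) (p'.isLocalNormPair v)
    exact ⟨k, hk, hkp⟩
  exact UnitaryGroup.isConj_of_isConj_archPart_of_forall_exists_conj (↥(maximalRealSubfield L)) L (IsCMField.complexConj L) 3 H' ha' hv' hK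

/-! ## §4 (surj) every admissible family of local classes and archimedean class is read by a class of `𝒞_𝐀(γ_H)` -/

/-- **(surj)**: let `γ_H → γ` (`γ ∈ U(H′)(L⁺)` rational).  Every family `δ` of local classes with `(γ_H)_v → out (δ v)` at every `v` and `δ v = [γ_v]` for
almost all `v`, together with every archimedean class `b` with `γ_H ⊗ 1 → out b`, is the family of local ∕ archimedean classes of some `c ∈ 𝒞_𝐀(γ_H)` — glue
the representatives (`γ_v` on the base classes, so integral a.e.: ★ `eventually_toLocal_mem_cmLocalIntegralLevel`) by ★ `UnitaryGroup.exists_adelic_of_eventually_mem`;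
the glued adèle is matching since `→` is constant on stable classes. [cite: Rogawski1990, §3.3 p. 21; §5.4 p. 72] [cite: BorelJacquet1979, §4.1] -/
theorem MatchingAdele.exists_mem_classes_of_forall {γ : (UnitaryGroup.cmDatum L 3 H').Rational} (hγ : IsNormPair L H' γH γ)
    (δ : ∀ v : HeightOneSpectrum (𝓞 ↥(maximalRealSubfield L)), ConjClasses ((UnitaryGroup.cmDatum L 3 H').Local v))
    (b : ConjClasses (UnitaryGroup.arch (↥(maximalRealSubfield L)) L (IsCMField.complexConj L) 3 H'))
    (hδ : ∀ v, IsLocalNormPair L H' v (rationalComponent L γH v) (Quotient.out (δ v)))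
    (hev : ∀ᶠ v in cofinite, δ v = ConjClasses.mk ((UnitaryGroup.cmDatum L 3 H').toLocal v ((UnitaryGroup.cmDatum L 3 H').toAdelic γ)))
    (hb : IsArchNormPair L H' (rationalArch L γH) (Quotient.out b)) :
    ∃ c ∈ adelicStableClassesOver L H' γH,
      (∀ v, ConjClasses.map ((UnitaryGroup.cmDatum L 3 H').toLocal v) c = δ v) ∧
      ConjClasses.map (UnitaryGroup.archPart (↥(maximalRealSubfield L)) L (IsCMField.complexConj L) 3 H') c = b := by
  classical
  -- representatives: `γ_v` on the base classes, `out (δ v)` elsewhere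
  let γv : ∀ v : HeightOneSpectrum (𝓞 ↥(maximalRealSubfield L)), (UnitaryGroup.cmDatum L 3 H').Local v := fun v =>
    (UnitaryGroup.cmDatum L 3 H').toLocal v ((UnitaryGroup.cmDatum L 3 H').toAdelic γ)
  let y : ∀ v : HeightOneSpectrum (𝓞 ↥(maximalRealSubfield L)), (UnitaryGroup.cmDatum L 3 H').Local v := fun v =>
    if δ v = ConjClasses.mk (γv v) then γv v else Quotient.out (δ v)
  have hy_mk : ∀ v, ConjClasses.mk (y v) = δ v := by
    intro v
    by_cases h : δ v = ConjClasses.mk (γv v)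
    · rw [show y v = γv v from if_pos h, h]
    · rw [show y v = Quotient.out (δ v) from if_neg h]
      exact conjClasses_mk_out_eq _
  have hy_int : ∀ᶠ v in cofinite, y v ∈ UnitaryGroup.localIntegralLevel (IsCMField.complexConj L) 3 H' v := by
    filter_upwards [hev, eventually_toLocal_mem_cmLocalIntegralLevel ((UnitaryGroup.cmDatum L 3 H').toAdelic γ)] with v hv hint
    have : y v = γv v := if_pos hv
    rw [this]
    exact hint
  obtain ⟨x, hxa, hxv⟩ := UnitaryGroup.exists_adelic_of_eventually_mem (↥(maximalRealSubfield L)) L (IsCMField.complexConj L) 3 H'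
    (Quotient.out b) y hy_int
  -- read `x` and its components on the `cmDatum` carriers (definitionally the same objects)
  have hxv' : ∀ v, (UnitaryGroup.cmDatum L 3 H').toLocal v x = y v := fun v => hxv v
  -- `x` is a matching adèle over `γ_H`
  have hxnorm : ∀ v, IsLocalNormPair L H' v (rationalComponent L γH v) ((UnitaryGroup.cmDatum L 3 H').toLocal v x) := by
    intro v
    rw [hxv' v]
    by_cases h : δ v = ConjClasses.mk (γv v)
    · have : y v = γv v := if_pos h
      rw [this]
      exact isLocalNormPair_rationalComponent_toLocal_toAdelic hγ v
    · have : y v = Quotient.out (δ v) := if_neg h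
      rw [this]
      exact hδ v
  let p : MatchingAdele L H' γH := ⟨x, hxnorm, by
    show IsArchNormPair L H' (rationalArch L γH) (UnitaryGroup.archPart (↥(maximalRealSubfield L)) L (IsCMField.complexConj L) 3 H' x)
    rw [hxa]
    exact hb⟩
  refine ⟨ConjClasses.mk p.adele, ⟨p, rfl⟩, fun v => ?_, ?_⟩
  · rw [conjClasses_map_mk]
    exact (congrArg ConjClasses.mk (hxv' v)).trans (hy_mk v)
  · exact (congrArg ConjClasses.mk hxa).trans (conjClasses_mk_out_eq b)

end DictionaryGp

end Literature.NumberTheory.Rogawski1990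

end
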